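import Literature.Geometry.Riemannian.CutLocusGeodesic
import Literature.Geometry.Riemannian.GeodesicBallsMetric
import HarnessLib

/-!
# A cut point is conjugate along its minimizing geodesic or is reached by two minimizers

Topic `Geometry/Riemannian`; sixth support file of the programme towards the named fact
`Literature.Geometry.Riemannian.buchner1977_cutLocus_triangulable` of `CutLocus.lean`
(M. A. Buchner, *Simplicial structure of the real analytic cut locus*, Proc. AMS 64 (1977)
118–121). Buchner, p. 118: "`x ∈ C(p)` if and only if `x` is the first conjugate point on a
length minimizing geodesic starting at `p` and going through `x`, or there are at least two length
minimizing geodesics from `p` to `x`" (his reference [6]); this is the dichotomy behind his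
description `C(p) = {x | E|π⁻¹(x) has a degenerate minimum or at least two minima}` (p. 119).
This file proves the "only if" direction in the tree's vocabulary (`ExponentialMap.lean`:
`tangentCutLocus`, `IsConjugateVector` = critical vector of `exp_p`, `IsMinimizingUpTo`):

* `isConjugateVector_or_exists_ne_of_mem_tangentCutLocus` — for a smooth Riemannian metric with
  geodesically complete Levi-Civita connection on a connected Hausdorff manifold without boundary,
  if `v ∈ TCL(p)` then either `v` is a conjugate (critical) vector of `exp_p`, or there is a second
  minimizing segment `γ_w|[0,1]`, `w ≠ v`, with `exp_p w = exp_p v`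
  (Lee 2018, Thm. 10.33 (c) ⇒ (a) or (b) in the form of Prop. 10.32 / do Carmo, Prop. 13.2.2).
* `exists_minimizer_of_mem_cutLocus` — consequently, on such manifolds, every `q ∈ cutLocus p`
  is `exp_p v` for some minimizing `γ_v|[0,1]` with `v` conjugate or accompanied by a second
  minimizer `γ_w|[0,1]`, `w ≠ v`, `exp_p w = q` (the converse for the second alternative is the
  corner-cutting argument of `CutLocusGeodesic.lean`; the converse for the conjugate alternative —
  "geodesics do not minimize past conjugate points", Lee Thm. 10.26, index form — is NOT proved
  here, so only this direction is stated).

## Proof (do Carmo 1992, Prop. 13.2.2; Lee 2018, proof of Thm. 10.33)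

Let `v ∈ TCL(p)`, `sₖ = 1 + 1/(k+1) ↓ 1`. By Hopf–Rinow choose minimizing `γ_{wₖ}|[0,1]` from `p`
to `γ_v(sₖ)`; `wₖ ≠ sₖ v` because `γ_v|[0,sₖ]` does not minimize, and `|wₖ| = d(p, γ_v(sₖ)) ≤ 2|v|`.
A subsequence converges, `wₖ → w` (compactness of `g_p`-balls, `isCompact_setOf_val_le`);
continuity of `exp_p` (`contMDiff_riemannianExpMap`) gives `exp_p w = exp_p v`, and
`|w| = d(p, exp_p v) = |v|` makes `γ_w|[0,1]` minimizing. If `w ≠ v` we are done. If `w = v` and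
`v` were not critical for `exp_p`, the inverse function theorem
(`isLocalDiffeomorphAt_of_mfderiv_of_normedSpace`) would make `exp_p` injective near `v`, where
eventually both `wₖ` and `sₖ v` lie and have the same image — contradicting `wₖ ≠ sₖ v`.

No definitions, no named facts (D-0026); theorem-only file.

## References

* [Buchner1977Simplicial] M. A. Buchner, Proc. AMS 64 (1977), pp. 118–119.
* [LeeRiemannianManifolds2018] J. M. Lee, Introduction to Riemannian Manifolds, 2nd ed. (2018),
  Prop. 10.32, Thm. 10.33, Thm. 10.34.
* [doCarmo1992] M. P. do Carmo, Riemannian Geometry (1992), Ch. 13, Prop. 2.2.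
-/

noncomputable section

open Bundle Set Filter Manifold Function
open scoped Manifold ContDiff Topology ENNReal NNReal

namespace Literature.Geometry.Riemannian

open Literature.Geometry.Lorentzian
open Literature.Geometry.Lorentzian.PseudoRiemannianMetric

variable {E : Type*} [NormedAddCommGroup E] [NormedSpace ℝ E] {H : Type*} [TopologicalSpace H]
  {I : ModelWithCorners ℝ E H} {M : Type*} [TopologicalSpace M] [ChartedSpace H M]
  [IsManifold I ∞ M] {n : ℕ∞ω} [FiniteDimensional ℝ E] [CompleteSpace E] [T2Space M]
  [BoundarylessManifold I M]
  {g : PseudoRiemannianMetric I n E (TangentSpace I : M → Type _)} [g.HasLeviCivita]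
  [CovariantDerivative.ContMDiffCovariantDerivative g.leviCivita 1]

/-! ### Local injectivity of `exp_p` at non-conjugate vectors -/

/-- **`exp_p` is injective near a non-conjugate vector** (Lee 2018, Prop. 10.20 with the inverse
function theorem, Lee 2013 Thm. 4.5): for a smooth metric with complete Levi-Civita connection, if
`v` is not a critical vector of `exp_p` then `exp_p` is injective on a neighbourhood of `v` in
`T_pM = E`. (`d(exp_p)_v` is an injective endomorphism of the finite-dimensional `E`, hence an
isomorphism; `isLocalDiffeomorphAt_of_mfderiv_of_normedSpace`.)
[cite: LeeRiemannianManifolds2018, Prop. 10.20] -/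
theorem exists_nhds_injOn_expMap_of_not_isConjugateVector (hn : (∞ : ℕ∞ω) ≤ n)
    (hc : IsGeodesicallyComplete g.leviCivita) {p : M} {v : TangentSpace I p}
    (hv : ¬ IsConjugateVector g p v) :
    ∃ U ∈ 𝓝 (show E from v),
      InjOn (fun w : E => riemannianExpMap g p (show TangentSpace I p from w)) U := by
  have hdom : v ∈ riemannianExpDomain g p := by
    show v ∈ expDomain g.leviCivita p
    rw [expDomain_eq_univ (cov := g.leviCivita) hc p]
    exact mem_univ _
  have hinjD : Injective
      (mfderiv 𝓘(ℝ, E) I (fun w : E => riemannianExpMap g p (show TangentSpace I p from w))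
        (show E from v)) := by
    by_contra h
    exact hv ⟨hdom, h⟩
  set f : E → M := fun w : E => riemannianExpMap g p (show TangentSpace I p from w) with hf
  -- the differential as an endomorphism of `E`
  set D : E →L[ℝ] E := mfderiv 𝓘(ℝ, E) I f (show E from v) with hD
  have hinj' : Injective D := hinjD
  have hbij : Bijective D :=
    ⟨hinj', LinearMap.injective_iff_surjective.1 (show Injective D.toLinearMap from hinj')⟩
  set e : E ≃L[ℝ] E := (LinearEquiv.ofBijective D.toLinearMap hbij).toContinuousLinearEquiv
    with he
  have heD : mfderiv 𝓘(ℝ, E) I f (show E from v) = (e : E →L[ℝ] E) := by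
    ext w
    rfl
  have hsmooth : ContMDiffOn 𝓘(ℝ, E) I ∞ f univ :=
    (contMDiff_riemannianExpMap g hn hc p).contMDiffOn
  have hinf0 : (∞ : ℕ∞ω) ≠ 0 :=
    (lt_of_lt_of_le zero_lt_one (by exact_mod_cast (le_top : (1 : ℕ∞) ≤ ⊤))).ne'
  have hloc : IsLocalDiffeomorphAt 𝓘(ℝ, E) I ∞ f (show E from v) :=
    Literature.Geometry.Manifold.isLocalDiffeomorphAt_of_mfderiv_of_normedSpace hinf0
      isOpen_univ (mem_univ _) hsmooth e heD
  obtain ⟨Φ, hvΦ, heq⟩ := hloc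
  refine ⟨Φ.source, Φ.open_source.mem_nhds hvΦ, fun a ha b hb hab => ?_⟩
  have hab' : Φ a = Φ b := by
    rw [← heq ha, ← heq hb]
    exact hab
  exact Φ.toPartialEquiv.injOn ha hb hab'

/-! ### The dichotomy at a cut point -/

/-- **A tangent cut vector is conjugate or doubled** (Lee 2018, Thm. 10.33 / Prop. 10.32;
do Carmo 1992, Ch. 13, Prop. 2.2; the "only if" of Buchner's characterisation of `C(p)`,
p. 118). For a smooth Riemannian metric with geodesically complete Levi-Civita connection on a
connected Hausdorff manifold without boundary: if `v ∈ TCL(p)` then `v` is a conjugate (critical)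
vector of `exp_p`, or there is `w ≠ v` with `γ_w|[0,1]` minimizing and `exp_p w = exp_p v`. See the
module docstring for the proof. [cite: LeeRiemannianManifolds2018, Prop. 10.32 and Thm. 10.33] -/
theorem isConjugateVector_or_exists_ne_of_mem_tangentCutLocus [ConnectedSpace M]
    (hn : (∞ : ℕ∞ω) ≤ n) (hg : g.IsRiemannian) (hc : IsGeodesicallyComplete g.leviCivita) {p : M}
    {v : TangentSpace I p} (hv : v ∈ tangentCutLocus g hg p) :
    IsConjugateVector g p v ∨ ∃ w : TangentSpace I p, w ≠ v ∧ IsMinimizingUpTo g hg p w 1 ∧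
      riemannianExpMap g p w = riemannianExpMap g p v := by
  haveI := fact_one_le_of_infty_le hn
  obtain ⟨hv0, hmin, hnot⟩ := hv
  by_cases hconj : IsConjugateVector g p v
  · exact Or.inl hconj
  right
  obtain ⟨ℓ, hℓ⟩ : ∃ ℓ : ℝ, ℓ = Real.sqrt (g.val p v v) := ⟨_, rfl⟩
  have hℓpos : 0 < ℓ := by
    rw [hℓ]
    exact Real.sqrt_pos.2 (hg p v hv0)
  have hnn : ∀ u : TangentSpace I p, 0 ≤ g.val p u u := fun u => by
    by_cases hu : u = 0
    · simp [hu]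
    · exact (hg p u hu).le
  have hdom := (maximalGeodesic_of_isGeodesicallyComplete hc p v).1
  have h0 := (maximalGeodesic_of_isGeodesicallyComplete hc p v).2.2.1
  have hq1 : riemannianExpMap g p v = maximalGeodesic g.leviCivita p v 1 :=
    expMap_eq_maximalGeodesic hc p v
  have hdpq : g.edist hg p (riemannianExpMap g p v) = ENNReal.ofReal ℓ := by
    rw [hℓ]
    exact edist_eq_of_isMinimizingUpTo hg hc hmin
  -- the parameters `sₖ = 1 + 1/(k+1)` and the minimizing vectors `wₖ` to `γ_v(sₖ)`
  set s : ℕ → ℝ := fun k => 1 + 1 / ((k : ℝ) + 1) with hs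
  have hs1 : ∀ k, 1 < s k := fun k => by
    simp only [hs]
    have : (0 : ℝ) < 1 / ((k : ℝ) + 1) := by positivity
    linarith
  have hs2 : ∀ k, s k ≤ 2 := fun k => by
    simp only [hs]
    have h1 : 1 / ((k : ℝ) + 1) ≤ 1 := by
      rw [div_le_one (by positivity)]
      linarith [(Nat.cast_nonneg k : (0 : ℝ) ≤ k)]
    linarith
  have hslim : Tendsto s atTop (𝓝 1) := by
    have h := (tendsto_one_div_add_atTop_nhds_zero_nat).const_add (1 : ℝ)
    rw [add_zero] at h
    exact h
  have hHR := fun k : ℕ => exists_isMinimizingUpTo_of_isGeodesicallyComplete (g := g) hn hg hc p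
    (riemannianExpMap g p (s k • v))
  choose w hw using hHR
  -- `wₖ ≠ sₖ v`
  have hne : ∀ k, w k ≠ s k • v := by
    intro k h
    have hm := (hw k).1
    rw [h, isMinimizingUpTo_smul_iff hg hc p v (zero_lt_one.trans (hs1 k)), mul_one] at hm
    exact hnot (s k) (hs1 k) hm
  -- `|wₖ| ≤ sₖ |v| ≤ 2 |v|`
  have hbound : ∀ k, g.val p (w k) (w k) ≤ (s k * ℓ) ^ 2 := by
    intro k
    have hsk0 : 0 ≤ s k := zero_le_one.trans (hs1 k).le
    have h1 : g.edist hg p (riemannianExpMap g p (w k)) =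
        ENNReal.ofReal (Real.sqrt (g.val p (w k) (w k))) := edist_eq_of_isMinimizingUpTo hg hc (hw k).1
    have h2 : g.edist hg p (riemannianExpMap g p (s k • v)) ≤ ENNReal.ofReal (s k * ℓ) := by
      rw [riemannianExpMap_eq, expMap_smul hc]
      have h := edist_maximalGeodesic_le_length hg hc p v hsk0
      rw [length_maximalGeodesic hg hc p v 0 (s k), h0, sub_zero, ← hℓ] at h
      exact h
    rw [(hw k).2] at h1
    rw [h1] at h2
    have h3 : Real.sqrt (g.val p (w k) (w k)) ≤ s k * ℓ :=
      (ENNReal.ofReal_le_ofReal_iff (by positivity)).1 h2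
    calc g.val p (w k) (w k) = Real.sqrt (g.val p (w k) (w k)) ^ 2 := by
          rw [Real.sq_sqrt (hnn _)]
      _ ≤ (s k * ℓ) ^ 2 := by gcongr
  -- a convergent subsequence
  have hK : IsCompact {u : E | g.val p (show TangentSpace I p from u) (show TangentSpace I p from u)
      ≤ (2 * ℓ) ^ 2} := isCompact_setOf_val_le hg p _
  have hwK : ∀ k, (show E from w k) ∈ {u : E | g.val p (show TangentSpace I p from u)
      (show TangentSpace I p from u) ≤ (2 * ℓ) ^ 2} := by
    intro k
    show g.val p (w k) (w k) ≤ (2 * ℓ) ^ 2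
    refine (hbound k).trans ?_
    have hsk0 : 0 ≤ s k := zero_le_one.trans (hs1 k).le
    gcongr
    exact hs2 k
  obtain ⟨w₀, -, φ, hφ, hlim⟩ := hK.tendsto_subseq hwK
  -- continuity of `exp_p` : `exp_p w₀ = exp_p v`
  have hexpc : Continuous fun u : E => riemannianExpMap g p (show TangentSpace I p from u) :=
    (contMDiff_riemannianExpMap g hn hc p).continuous
  have hsφ : Tendsto (fun k => s (φ k)) atTop (𝓝 1) := hslim.comp hφ.tendsto_atTop
  have hlim2 : Tendsto (fun k => (show E from s (φ k) • v)) atTop (𝓝 (show E from v)) := by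
    have h := hsφ.smul_const (show E from v)
    rwa [one_smul] at h
  have himage : ∀ k, riemannianExpMap g p (w (φ k)) = riemannianExpMap g p (s (φ k) • v) :=
    fun k => (hw (φ k)).2
  have hexp_w₀ : riemannianExpMap g p (show TangentSpace I p from w₀) = riemannianExpMap g p v := by
    have hA : Tendsto (fun k => riemannianExpMap g p (w (φ k))) atTop
        (𝓝 (riemannianExpMap g p (show TangentSpace I p from w₀))) := hexpc.continuousAt.tendsto.comp hlim
    have hB : Tendsto (fun k => riemannianExpMap g p (s (φ k) • v)) atTop
        (𝓝 (riemannianExpMap g p v)) := hexpc.continuousAt.tendsto.comp hlim2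
    have hA' : Tendsto (fun k => riemannianExpMap g p (s (φ k) • v)) atTop
        (𝓝 (riemannianExpMap g p (show TangentSpace I p from w₀))) := by
      refine hA.congr fun k => ?_
      exact himage k
    exact tendsto_nhds_unique hA' hB
  -- `|w₀| = |v|`
  have hval_cont : Continuous fun u : E => g.val p (show TangentSpace I p from u)
      (show TangentSpace I p from u) := by
    obtain ⟨G, hG⟩ : ∃ G : E →L[ℝ] E →L[ℝ] ℝ, G = g.val p := ⟨_, rfl⟩
    have h := G.continuous₂.comp (continuous_id.prodMk continuous_id)
    rw [hG] at h
    exact h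
  have hle : g.val p (show TangentSpace I p from w₀) (show TangentSpace I p from w₀) ≤ ℓ ^ 2 := by
    have hA : Tendsto (fun k => g.val p (w (φ k)) (w (φ k))) atTop
        (𝓝 (g.val p (show TangentSpace I p from w₀) (show TangentSpace I p from w₀))) :=
      hval_cont.continuousAt.tendsto.comp hlim
    have hB : Tendsto (fun k => (s (φ k) * ℓ) ^ 2) atTop (𝓝 (ℓ ^ 2)) := by
      have h := (hsφ.mul_const ℓ).pow 2
      rwa [one_mul] at h
    exact le_of_tendsto_of_tendsto' hA hB fun k => hbound (φ k)
  have hge : ℓ ^ 2 ≤ g.val p (show TangentSpace I p from w₀) (show TangentSpace I p from w₀) := by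
    -- `ℓ = d(p, exp_p w₀) ≤ L(γ_{w₀}|[0,1]) = |w₀|`
    have h1 : g.edist hg p (riemannianExpMap g p (show TangentSpace I p from w₀)) ≤
        ENNReal.ofReal (Real.sqrt (g.val p (show TangentSpace I p from w₀)
          (show TangentSpace I p from w₀))) := by
      rw [riemannianExpMap_eq, expMap_eq_maximalGeodesic hc]
      have h := edist_maximalGeodesic_le_length hg hc p (show TangentSpace I p from w₀) zero_le_one
      rw [length_maximalGeodesic hg hc p _ 0 1,
        (maximalGeodesic_of_isGeodesicallyComplete hc p (show TangentSpace I p from w₀)).2.2.1,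
        sub_zero, one_mul] at h
      exact h
    rw [hexp_w₀, hdpq] at h1
    have h2 : ℓ ≤ Real.sqrt (g.val p (show TangentSpace I p from w₀)
        (show TangentSpace I p from w₀)) :=
      (ENNReal.ofReal_le_ofReal_iff (Real.sqrt_nonneg _)).1 h1
    calc ℓ ^ 2 ≤ Real.sqrt (g.val p (show TangentSpace I p from w₀)
          (show TangentSpace I p from w₀)) ^ 2 := by gcongr
      _ = _ := Real.sq_sqrt (hnn _)
  have hval : g.val p (show TangentSpace I p from w₀) (show TangentSpace I p from w₀) = ℓ ^ 2 :=
    le_antisymm hle hge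
  have hsqrt : Real.sqrt (g.val p (show TangentSpace I p from w₀) (show TangentSpace I p from w₀))
      = ℓ := by
    rw [hval, Real.sqrt_sq hℓpos.le]
  -- `γ_{w₀}|[0,1]` is minimizing
  have hw₀min : IsMinimizingUpTo g hg p (show TangentSpace I p from w₀) 1 := by
    refine ⟨by rw [(maximalGeodesic_of_isGeodesicallyComplete hc p _).1]; exact subset_univ _, ?_⟩
    rw [length_maximalGeodesic hg hc p _ 0 1, sub_zero, one_mul, hsqrt,
      ← expMap_eq_maximalGeodesic hc p _]
    change ENNReal.ofReal ℓ = g.edist hg p (riemannianExpMap g p (show TangentSpace I p from w₀))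
    rw [hexp_w₀, hdpq]
  -- `w₀ ≠ v`, by local injectivity of `exp_p` at the non-conjugate vector `v`
  refine ⟨show TangentSpace I p from w₀, fun hw₀v => ?_, hw₀min, hexp_w₀⟩
  obtain ⟨U, hU, hinj⟩ := exists_nhds_injOn_expMap_of_not_isConjugateVector hn hc hconj
  have hU' : U ∈ 𝓝 (show E from w₀) := by
    rw [show (show E from w₀) = (show E from v) from hw₀v]
    exact hU
  have h1 : ∀ᶠ k in atTop, (show E from w (φ k)) ∈ U := hlim.eventually_mem hU'
  have h2 : ∀ᶠ k in atTop, (show E from s (φ k) • v) ∈ U := hlim2.eventually_mem hU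
  obtain ⟨k, hk1, hk2⟩ := (h1.and h2).exists
  exact hne (φ k) (hinj hk1 hk2 (himage k))

/-- **Every cut point is conjugate along a minimizing geodesic or reached by two minimizers**
(Buchner 1977, p. 118, "only if"; Lee 2018, Thm. 10.33): on a connected Hausdorff manifold without
boundary with a smooth Riemannian metric whose Levi-Civita connection is geodesically complete,
every `q ∈ cutLocus p` is `exp_p v` with `γ_v|[0,1]` minimizing and either `v` a conjugate
(critical) vector of `exp_p` or a second minimizing `γ_w|[0,1]`, `w ≠ v`, ending at `q`
(Hopf–Rinow, `mem_tangentCutLocus_of_mem_cutLocus`,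
`isConjugateVector_or_exists_ne_of_mem_tangentCutLocus`).
[cite: Buchner1977Simplicial, p. 118 (characterisation of C(p))] -/
theorem exists_minimizer_of_mem_cutLocus [ConnectedSpace M] (hn : (∞ : ℕ∞ω) ≤ n)
    (hg : g.IsRiemannian) (hc : IsGeodesicallyComplete g.leviCivita) {p q : M}
    (hq : q ∈ cutLocus g hg p) :
    ∃ v : TangentSpace I p, IsMinimizingUpTo g hg p v 1 ∧ riemannianExpMap g p v = q ∧
      (IsConjugateVector g p v ∨ ∃ w : TangentSpace I p, w ≠ v ∧ IsMinimizingUpTo g hg p w 1 ∧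
        riemannianExpMap g p w = q) := by
  obtain ⟨v, hmin, hvq⟩ := exists_isMinimizingUpTo_of_isGeodesicallyComplete (g := g) hn hg hc p q
  have hv : v ∈ tangentCutLocus g hg p := mem_tangentCutLocus_of_mem_cutLocus hn hg hc hq hmin hvq
  refine ⟨v, hmin, hvq, ?_⟩
  rcases isConjugateVector_or_exists_ne_of_mem_tangentCutLocus hn hg hc hv with h | ⟨w, hwv, hw, he⟩
  · exact Or.inl h
  · exact Or.inr ⟨w, hwv, hw, he.trans hvq⟩

end Literature.Geometry.Riemannian

end
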